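import Summits.KontsevichZagierPeriods.KontsevichZagierPeriods.Theses.HyperbolicBloch

/-!
# `PachnerTwoThree`: the stubs of line `exchange-identity-symmdiff` are stated at minimal strength

Negative knowledge for the crux `HyperbolicBloch.PachnerTwoThree`
(stmt-KontsevichZagierPeriods-3470), line `exchange-identity-symmdiff`
(refuter, drefute, 2026-08-16).  The line has two registered stubs, both THEOREMS (crux work
file `Cruxes/PachnerTwoThree/Disproof.lean` §2 `two_three_pointwise`, §3
`volume_scaffold_eq_zero`, signatures verbatim):

* `stub_exchangePointwise` — for `q̂` strictly inside the counter-clockwise ideal triangle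
  `(u,v,w)` and `p` off the scaffold `{S u v w = 0} ∪ {L u q = 0} ∪ {L v q = 0} ∪ {L w q = 0}`,
  `p ∈ prism(u,v,w) ∪ inner(q;u,v,w) ↔ p ∈ prism(u,v,q) ∪ prism(v,w,q) ∪ prism(w,u,q)`;
* `stub_nullScaffold` — that scaffold is Lebesgue-null.

Below (§1): each of the SEVEN hypotheses of `stub_exchangePointwise` is individually
load-bearing — the stub with any single hypothesis deleted, everything else verbatim, is FALSE by
an explicit rational witness (`norm_num`).  So the null scaffold of the 2–3 move cannot be
shrunk: the identity fails on the big hemisphere (over each small triangle) and on each spoke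
plane (over the open segment from the vertex to `q̂`); and it fails as soon as `q̂` leaves the
closed triangle across one edge (cf. `Negative/WithoutInteriorAE.lean` for the a.e. version).
(§2): `stub_nullScaffold` with two interior hypotheses deleted is FALSE (`q = w` allowed, a spoke
plane degenerates to the whole space); with one deleted it stays true (not formalised).
-/

noncomputable section

open Set MeasureTheory

namespace Summit.KontsevichZagierPeriods.HyperbolicBloch.ExchangeStubsMinimal

/-! ## §1 `stub_exchangePointwise`: every hypothesis is load-bearing -/

/-- **The first interior hypothesis `0 < L u v q̂` is load-bearing for `stub_exchangePointwise`**: the stub with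
this hypothesis deleted (everything else verbatim) is false.  Witness: configuration `(u,v,w,q) = (−5, 5, 5i, −2i)` (q̂ strictly across the edge `uv`, inside the circumcircle) and `p = (−1,−1,10)`: `p` lies in the typed `prism(w,u,q)` (RHS true) but `L u v p < 0 < S u v w p`, so `p` is in neither `prism(u,v,w)` nor the inner piece (LHS false). -/
theorem not_exchangePointwise_without_interior₁ : ¬ (
  ∀ (L : ℂ → ℂ → (Fin 3 → ℝ) → ℝ), (∀ u v p, L u v p = (v.re - u.re) * (p 1 - u.im) - (v.im - u.im) * (p 0 - u.re)) → ∀ (S : ℂ → ℂ → ℂ → (Fin 3 → ℝ) → ℝ), (∀ u v w p, S u v w p = (p 0 ^ 2 + p 1 ^ 2 + p 2 ^ 2) * (u.re * (v.im - w.im) - u.im * (v.re - w.re) + (v.re * w.im - v.im * w.re)) - p 0 * (Complex.normSq u * (v.im - w.im) - u.im * (Complex.normSq v - Complex.normSq w) + (Complex.normSq v * w.im - v.im * Complex.normSq w)) + p 1 * (Complex.normSq u * (v.re - w.re) - u.re * (Complex.normSq v - Complex.normSq w) + (Complex.normSq v * w.re - v.re * Complex.normSq w)) - (Complex.normSq u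 * (v.re * w.im - v.im * w.re) - u.re * (Complex.normSq v * w.im - v.im * Complex.normSq w) + u.im * (Complex.normSq v * w.re - v.re * Complex.normSq w))) → ∀ (u v w q : ℂ), 0 < L v w ![q.re, q.im, 0] → 0 < L w u ![q.re, q.im, 0] → ∀ (p : Fin 3 → ℝ), S u v w p ≠ 0 → L u q p ≠ 0 → L v q p ≠ 0 → L w q p ≠ 0 → (((0 < p 2 ∧ 0 < L u v p ∧ 0 < L v w p ∧ 0 < L w u p ∧ 0 < S u v w p) ∨ (0 < p 2 ∧ S u v w p < 0 ∧ 0 < S u v q p ∧ 0 < S v w q p ∧ 0 < S w u q p)) ↔ ((0 < p 2 ∧ 0 < L u v p ∧ 0 < L v q p ∧ 0 < L q u p ∧ 0 < S u v q p) ∨ (0 < p 2 ∧ 0 < L v w p ∧ 0 < L w q p ∧ 0 < L q v p ∧ 0 < S v w q p) ∨ (0 < p 2 ∧ 0 < L w u p ∧ 0 < L u q p ∧ 0 < L q w p ∧ 0 < S w u q p)))) := by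
  intro h
  set p : Fin 3 → ℝ := ![-1, -1, 10] with hp
  have h0 : p 0 = -1 := rfl
  have h1 : p 1 = -1 := rfl
  have h2 : p 2 = 10 := rfl
  have key := h (fun u v p => (v.re - u.re) * (p 1 - u.im) - (v.im - u.im) * (p 0 - u.re)) (fun _ _ _ => rfl)
    (fun u v w p => (p 0 ^ 2 + p 1 ^ 2 + p 2 ^ 2) * (u.re * (v.im - w.im) - u.im * (v.re - w.re) + (v.re * w.im - v.im * w.re)) - p 0 * (Complex.normSq u * (v.im - w.im) - u.im * (Complex.normSq v - Complex.normSq w) + (Complex.normSq v * w.im - v.im * Complex.normSq w)) + p 1 * (Complex.normSq u * (v.re - w.re) - u.re * (Complex.normSq v - Complex.normSq w) + (Complex.normSq v * w.re - v.re * Complex.normSq w)) - (Complex.normSq u * (v.re * w.im - v.im * w.re) - u.re * (Complex.normSq v * w.im - v.im * Complex.normSq w) + u.im * (Complex.normSq v * w.re - v.re * Complex.normSq w))) (fun _ _ _ _ => rfl)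
    ⟨-5, 0⟩ ⟨5, 0⟩ ⟨0, 5⟩ ⟨0, -2⟩
    (by norm_num) (by norm_num) p
    (by norm_num [h0, h1, h2]) (by norm_num [h0, h1, h2]) (by norm_num [h0, h1, h2]) (by norm_num [h0, h1, h2])
  norm_num [h0, h1, h2] at key

/-- **The second interior hypothesis `0 < L v w q̂` is load-bearing for `stub_exchangePointwise`**: the stub with
this hypothesis deleted (everything else verbatim) is false.  Witness: the cyclic relabelling `(u,v,w) := (5i, −5, 5)` of the `interior₁` witness, `q = −2i`, `p = (−1,−1,10)` (RHS true, LHS false). -/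
theorem not_exchangePointwise_without_interior₂ : ¬ (
  ∀ (L : ℂ → ℂ → (Fin 3 → ℝ) → ℝ), (∀ u v p, L u v p = (v.re - u.re) * (p 1 - u.im) - (v.im - u.im) * (p 0 - u.re)) → ∀ (S : ℂ → ℂ → ℂ → (Fin 3 → ℝ) → ℝ), (∀ u v w p, S u v w p = (p 0 ^ 2 + p 1 ^ 2 + p 2 ^ 2) * (u.re * (v.im - w.im) - u.im * (v.re - w.re) + (v.re * w.im - v.im * w.re)) - p 0 * (Complex.normSq u * (v.im - w.im) - u.im * (Complex.normSq v - Complex.normSq w) + (Complex.normSq v * w.im - v.im * Complex.normSq w)) + p 1 * (Complex.normSq u * (v.re - w.re) - u.re * (Complex.normSq v - Complex.normSq w) + (Complex.normSq v * w.re - v.re * Complex.normSq w)) - (Complex.normSq u * (v.re * w.im - v.im * w.re) - u.re * (Complex.normSq v * w.im - v.im * Complex.normSq w) + u.im * (Complex.normSq v * w.re - v.re * Complex.normSq w))) → ∀ (u v w q : ℂ), 0 < L u v ![q.re, q.im, 0] → 0 < L w u ![q.re, q.im, 0] → ∀ (p : Fin 3 → ℝ), S u v w p ≠ 0 → L u q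 p ≠ 0 → L v q p ≠ 0 → L w q p ≠ 0 → (((0 < p 2 ∧ 0 < L u v p ∧ 0 < L v w p ∧ 0 < L w u p ∧ 0 < S u v w p) ∨ (0 < p 2 ∧ S u v w p < 0 ∧ 0 < S u v q p ∧ 0 < S v w q p ∧ 0 < S w u q p)) ↔ ((0 < p 2 ∧ 0 < L u v p ∧ 0 < L v q p ∧ 0 < L q u p ∧ 0 < S u v q p) ∨ (0 < p 2 ∧ 0 < L v w p ∧ 0 < L w q p ∧ 0 < L q v p ∧ 0 < S v w q p) ∨ (0 < p 2 ∧ 0 < L w u p ∧ 0 < L u q p ∧ 0 < L q w p ∧ 0 < S w u q p)))) := by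
  intro h
  set p : Fin 3 → ℝ := ![-1, -1, 10] with hp
  have h0 : p 0 = -1 := rfl
  have h1 : p 1 = -1 := rfl
  have h2 : p 2 = 10 := rfl
  have key := h (fun u v p => (v.re - u.re) * (p 1 - u.im) - (v.im - u.im) * (p 0 - u.re)) (fun _ _ _ => rfl)
    (fun u v w p => (p 0 ^ 2 + p 1 ^ 2 + p 2 ^ 2) * (u.re * (v.im - w.im) - u.im * (v.re - w.re) + (v.re * w.im - v.im * w.re)) - p 0 * (Complex.normSq u * (v.im - w.im) - u.im * (Complex.normSq v - Complex.normSq w) + (Complex.normSq v * w.im - v.im * Complex.normSq w)) + p 1 * (Complex.normSq u * (v.re - w.re) - u.re * (Complex.normSq v - Complex.normSq w) + (Complex.normSq v * w.re - v.re * Complex.normSq w)) - (Complex.normSq u * (v.re * w.im - v.im * w.re) - u.re * (Complex.normSq v * w.im - v.im * Complex.normSq w) + u.im * (Complex.normSq v * w.re - v.re * Complex.normSq w))) (fun _ _ _ _ => rfl)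
    ⟨0, 5⟩ ⟨-5, 0⟩ ⟨5, 0⟩ ⟨0, -2⟩
    (by norm_num) (by norm_num) p
    (by norm_num [h0, h1, h2]) (by norm_num [h0, h1, h2]) (by norm_num [h0, h1, h2]) (by norm_num [h0, h1, h2])
  norm_num [h0, h1, h2] at key

/-- **The third interior hypothesis `0 < L w u q̂` is load-bearing for `stub_exchangePointwise`**: the stub with
this hypothesis deleted (everything else verbatim) is false.  Witness: the cyclic relabelling `(u,v,w) := (5, 5i, −5)` of the `interior₁` witness, `q = −2i`, `p = (−1,−1,10)` (RHS true, LHS false). -/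
theorem not_exchangePointwise_without_interior₃ : ¬ (
  ∀ (L : ℂ → ℂ → (Fin 3 → ℝ) → ℝ), (∀ u v p, L u v p = (v.re - u.re) * (p 1 - u.im) - (v.im - u.im) * (p 0 - u.re)) → ∀ (S : ℂ → ℂ → ℂ → (Fin 3 → ℝ) → ℝ), (∀ u v w p, S u v w p = (p 0 ^ 2 + p 1 ^ 2 + p 2 ^ 2) * (u.re * (v.im - w.im) - u.im * (v.re - w.re) + (v.re * w.im - v.im * w.re)) - p 0 * (Complex.normSq u * (v.im - w.im) - u.im * (Complex.normSq v - Complex.normSq w) + (Complex.normSq v * w.im - v.im * Complex.normSq w)) + p 1 * (Complex.normSq u * (v.re - w.re) - u.re * (Complex.normSq v - Complex.normSq w) + (Complex.normSq v * w.re - v.re * Complex.normSq w)) - (Complex.normSq u * (v.re * w.im - v.im * w.re) - u.re * (Complex.normSq v * w.im - v.im * Complex.normSq w) + u.im * (Complex.normSq v * w.re - v.re * Complex.normSq w))) → ∀ (u v w q : ℂ), 0 < L u v ![q.re, q.im, 0] → 0 < L v w ![q.re, q.im, 0] → ∀ (p : Fin 3 → ℝ), S u v w p ≠ 0 → L u q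 p ≠ 0 → L v q p ≠ 0 → L w q p ≠ 0 → (((0 < p 2 ∧ 0 < L u v p ∧ 0 < L v w p ∧ 0 < L w u p ∧ 0 < S u v w p) ∨ (0 < p 2 ∧ S u v w p < 0 ∧ 0 < S u v q p ∧ 0 < S v w q p ∧ 0 < S w u q p)) ↔ ((0 < p 2 ∧ 0 < L u v p ∧ 0 < L v q p ∧ 0 < L q u p ∧ 0 < S u v q p) ∨ (0 < p 2 ∧ 0 < L v w p ∧ 0 < L w q p ∧ 0 < L q v p ∧ 0 < S v w q p) ∨ (0 < p 2 ∧ 0 < L w u p ∧ 0 < L u q p ∧ 0 < L q w p ∧ 0 < S w u q p)))) := by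
  intro h
  set p : Fin 3 → ℝ := ![-1, -1, 10] with hp
  have h0 : p 0 = -1 := rfl
  have h1 : p 1 = -1 := rfl
  have h2 : p 2 = 10 := rfl
  have key := h (fun u v p => (v.re - u.re) * (p 1 - u.im) - (v.im - u.im) * (p 0 - u.re)) (fun _ _ _ => rfl)
    (fun u v w p => (p 0 ^ 2 + p 1 ^ 2 + p 2 ^ 2) * (u.re * (v.im - w.im) - u.im * (v.re - w.re) + (v.re * w.im - v.im * w.re)) - p 0 * (Complex.normSq u * (v.im - w.im) - u.im * (Complex.normSq v - Complex.normSq w) + (Complex.normSq v * w.im - v.im * Complex.normSq w)) + p 1 * (Complex.normSq u * (v.re - w.re) - u.re * (Complex.normSq v - Complex.normSq w) + (Complex.normSq v * w.re - v.re * Complex.normSq w)) - (Complex.normSq u * (v.re * w.im - v.im * w.re) - u.re * (Complex.normSq v * w.im - v.im * Complex.normSq w) + u.im * (Complex.normSq v * w.re - v.re * Complex.normSq w))) (fun _ _ _ _ => rfl)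
    ⟨5, 0⟩ ⟨0, 5⟩ ⟨-5, 0⟩ ⟨0, -2⟩
    (by norm_num) (by norm_num) p
    (by norm_num [h0, h1, h2]) (by norm_num [h0, h1, h2]) (by norm_num [h0, h1, h2]) (by norm_num [h0, h1, h2])
  norm_num [h0, h1, h2] at key

/-- **The scaffold hypothesis `S u v w p ≠ 0` is load-bearing for `stub_exchangePointwise`**: the stub with
this hypothesis deleted (everything else verbatim) is false.  Witness: `(u,v,w,q) = (0, 4, 4i, 1+i)` and the rational point `p = (2, 8/5, 14/5)` ON the big hemisphere `x²+y²+z² = 4x+4y`, over the open triangle `(v,w,q)` and off the spokes: RHS true (`p ∈ prism(v,w,q)`, `S v w q p = 48/5`), LHS false (`S u v w p = 0` is neither `> 0` nor `< 0`). -/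
theorem not_exchangePointwise_without_sphere : ¬ (
  ∀ (L : ℂ → ℂ → (Fin 3 → ℝ) → ℝ), (∀ u v p, L u v p = (v.re - u.re) * (p 1 - u.im) - (v.im - u.im) * (p 0 - u.re)) → ∀ (S : ℂ → ℂ → ℂ → (Fin 3 → ℝ) → ℝ), (∀ u v w p, S u v w p = (p 0 ^ 2 + p 1 ^ 2 + p 2 ^ 2) * (u.re * (v.im - w.im) - u.im * (v.re - w.re) + (v.re * w.im - v.im * w.re)) - p 0 * (Complex.normSq u * (v.im - w.im) - u.im * (Complex.normSq v - Complex.normSq w) + (Complex.normSq v * w.im - v.im * Complex.normSq w)) + p 1 * (Complex.normSq u * (v.re - w.re) - u.re * (Complex.normSq v - Complex.normSq w) + (Complex.normSq v * w.re - v.re * Complex.normSq w)) - (Complex.normSq u * (v.re * w.im - v.im * w.re) - u.re * (Complex.normSq v * w.im - v.im * Complex.normSq w) + u.im * (Complex.normSq v * w.re - v.re * Complex.normSq w))) → ∀ (u v w q : ℂ), 0 < L u v ![q.re, q.im, 0] → 0 < L v w ![q.re, q.im, 0] → 0 < L w u ![q.re, q.im, 0] → ∀ (p : Fin 3 → ℝ),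 L u q p ≠ 0 → L v q p ≠ 0 → L w q p ≠ 0 → (((0 < p 2 ∧ 0 < L u v p ∧ 0 < L v w p ∧ 0 < L w u p ∧ 0 < S u v w p) ∨ (0 < p 2 ∧ S u v w p < 0 ∧ 0 < S u v q p ∧ 0 < S v w q p ∧ 0 < S w u q p)) ↔ ((0 < p 2 ∧ 0 < L u v p ∧ 0 < L v q p ∧ 0 < L q u p ∧ 0 < S u v q p) ∨ (0 < p 2 ∧ 0 < L v w p ∧ 0 < L w q p ∧ 0 < L q v p ∧ 0 < S v w q p) ∨ (0 < p 2 ∧ 0 < L w u p ∧ 0 < L u q p ∧ 0 < L q w p ∧ 0 < S w u q p)))) := by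
  intro h
  set p : Fin 3 → ℝ := ![2, 8 / 5, 14 / 5] with hp
  have h0 : p 0 = 2 := rfl
  have h1 : p 1 = 8 / 5 := rfl
  have h2 : p 2 = 14 / 5 := rfl
  have key := h (fun u v p => (v.re - u.re) * (p 1 - u.im) - (v.im - u.im) * (p 0 - u.re)) (fun _ _ _ => rfl)
    (fun u v w p => (p 0 ^ 2 + p 1 ^ 2 + p 2 ^ 2) * (u.re * (v.im - w.im) - u.im * (v.re - w.re) + (v.re * w.im - v.im * w.re)) - p 0 * (Complex.normSq u * (v.im - w.im) - u.im * (Complex.normSq v - Complex.normSq w) + (Complex.normSq v * w.im - v.im * Complex.normSq w)) + p 1 * (Complex.normSq u * (v.re - w.re) - u.re * (Complex.normSq v - Complex.normSq w) + (Complex.normSq v * w.re - v.re * Complex.normSq w)) - (Complex.normSq u * (v.re * w.im - v.im * w.re) - u.re * (Complex.normSq v * w.im - v.im * Complex.normSq w) + u.im * (Complex.normSq v * w.re - v.re * Complex.normSq w))) (fun _ _ _ _ => rfl)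
    ⟨0, 0⟩ ⟨4, 0⟩ ⟨0, 4⟩ ⟨1, 1⟩
    (by norm_num) (by norm_num) (by norm_num) p
    (by norm_num [h0, h1, h2]) (by norm_num [h0, h1, h2]) (by norm_num [h0, h1, h2])
  norm_num [h0, h1, h2] at key

/-- **The scaffold hypothesis `L u q p ≠ 0` is load-bearing for `stub_exchangePointwise`**: the stub with
this hypothesis deleted (everything else verbatim) is false.  Witness: `(u,v,w,q) = (0, 4, 4i, 1+i)`, `p = (1/2, 1/2, 3)` on the spoke plane through `u, q`, over the open segment `(u,q)`, above the big hemisphere: LHS true (`p ∈ prism(u,v,w)`), RHS false (`prism(u,v,q)` needs `L q u p > 0` and `prism(w,u,q)` needs `L u q p > 0`, both vanish; `p` is not over the triangle `(v,w,q)`). -/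
theorem not_exchangePointwise_without_spokeU : ¬ (
  ∀ (L : ℂ → ℂ → (Fin 3 → ℝ) → ℝ), (∀ u v p, L u v p = (v.re - u.re) * (p 1 - u.im) - (v.im - u.im) * (p 0 - u.re)) → ∀ (S : ℂ → ℂ → ℂ → (Fin 3 → ℝ) → ℝ), (∀ u v w p, S u v w p = (p 0 ^ 2 + p 1 ^ 2 + p 2 ^ 2) * (u.re * (v.im - w.im) - u.im * (v.re - w.re) + (v.re * w.im - v.im * w.re)) - p 0 * (Complex.normSq u * (v.im - w.im) - u.im * (Complex.normSq v - Complex.normSq w) + (Complex.normSq v * w.im - v.im * Complex.normSq w)) + p 1 * (Complex.normSq u * (v.re - w.re) - u.re * (Complex.normSq v - Complex.normSq w) + (Complex.normSq v * w.re - v.re * Complex.normSq w)) - (Complex.normSq u * (v.re * w.im - v.im * w.re) - u.re * (Complex.normSq v * w.im - v.im * Complex.normSq w) + u.im * (Complex.normSq v * w.re - v.re * Complex.normSq w))) → ∀ (u v w q : ℂ), 0 < L u v ![q.re, q.im, 0] → 0 < L v w ![q.re, q.im, 0] → 0 < L w u ![q.re, q.im, 0] → ∀ (p : Fin 3 → ℝ),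 S u v w p ≠ 0 → L v q p ≠ 0 → L w q p ≠ 0 → (((0 < p 2 ∧ 0 < L u v p ∧ 0 < L v w p ∧ 0 < L w u p ∧ 0 < S u v w p) ∨ (0 < p 2 ∧ S u v w p < 0 ∧ 0 < S u v q p ∧ 0 < S v w q p ∧ 0 < S w u q p)) ↔ ((0 < p 2 ∧ 0 < L u v p ∧ 0 < L v q p ∧ 0 < L q u p ∧ 0 < S u v q p) ∨ (0 < p 2 ∧ 0 < L v w p ∧ 0 < L w q p ∧ 0 < L q v p ∧ 0 < S v w q p) ∨ (0 < p 2 ∧ 0 < L w u p ∧ 0 < L u q p ∧ 0 < L q w p ∧ 0 < S w u q p)))) := by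
  intro h
  set p : Fin 3 → ℝ := ![1 / 2, 1 / 2, 3] with hp
  have h0 : p 0 = 1 / 2 := rfl
  have h1 : p 1 = 1 / 2 := rfl
  have h2 : p 2 = 3 := rfl
  have key := h (fun u v p => (v.re - u.re) * (p 1 - u.im) - (v.im - u.im) * (p 0 - u.re)) (fun _ _ _ => rfl)
    (fun u v w p => (p 0 ^ 2 + p 1 ^ 2 + p 2 ^ 2) * (u.re * (v.im - w.im) - u.im * (v.re - w.re) + (v.re * w.im - v.im * w.re)) - p 0 * (Complex.normSq u * (v.im - w.im) - u.im * (Complex.normSq v - Complex.normSq w) + (Complex.normSq v * w.im - v.im * Complex.normSq w)) + p 1 * (Complex.normSq u * (v.re - w.re) - u.re * (Complex.normSq v - Complex.normSq w) + (Complex.normSq v * w.re - v.re * Complex.normSq w)) - (Complex.normSq u * (v.re * w.im - v.im * w.re) - u.re * (Complex.normSq v * w.im - v.im * Complex.normSq w) + u.im * (Complex.normSq v * w.re - v.re * Complex.normSq w))) (fun _ _ _ _ => rfl)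
    ⟨0, 0⟩ ⟨4, 0⟩ ⟨0, 4⟩ ⟨1, 1⟩
    (by norm_num) (by norm_num) (by norm_num) p
    (by norm_num [h0, h1, h2]) (by norm_num [h0, h1, h2]) (by norm_num [h0, h1, h2])
  norm_num [h0, h1, h2] at key

/-- **The scaffold hypothesis `L v q p ≠ 0` is load-bearing for `stub_exchangePointwise`**: the stub with
this hypothesis deleted (everything else verbatim) is false.  Witness: `(u,v,w,q) = (0, 4, 4i, 1+i)`, `p = (5/2, 1/2, 3)` on the spoke plane through `v, q` over the open segment `(v,q)`, above the big hemisphere: LHS true, RHS false. -/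
theorem not_exchangePointwise_without_spokeV : ¬ (
  ∀ (L : ℂ → ℂ → (Fin 3 → ℝ) → ℝ), (∀ u v p, L u v p = (v.re - u.re) * (p 1 - u.im) - (v.im - u.im) * (p 0 - u.re)) → ∀ (S : ℂ → ℂ → ℂ → (Fin 3 → ℝ) → ℝ), (∀ u v w p, S u v w p = (p 0 ^ 2 + p 1 ^ 2 + p 2 ^ 2) * (u.re * (v.im - w.im) - u.im * (v.re - w.re) + (v.re * w.im - v.im * w.re)) - p 0 * (Complex.normSq u * (v.im - w.im) - u.im * (Complex.normSq v - Complex.normSq w) + (Complex.normSq v * w.im - v.im * Complex.normSq w)) + p 1 * (Complex.normSq u * (v.re - w.re) - u.re * (Complex.normSq v - Complex.normSq w) + (Complex.normSq v * w.re - v.re * Complex.normSq w)) - (Complex.normSq u * (v.re * w.im - v.im * w.re) - u.re * (Complex.normSq v * w.im - v.im * Complex.normSq w) + u.im * (Complex.normSq v * w.re - v.re * Complex.normSq w))) → ∀ (u v w q : ℂ), 0 < L u v ![q.re, q.im, 0] → 0 < L v w ![q.re, q.im, 0] → 0 < L w u ![q.re, q.im, 0] → ∀ (p : Fin 3 → ℝ),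 S u v w p ≠ 0 → L u q p ≠ 0 → L w q p ≠ 0 → (((0 < p 2 ∧ 0 < L u v p ∧ 0 < L v w p ∧ 0 < L w u p ∧ 0 < S u v w p) ∨ (0 < p 2 ∧ S u v w p < 0 ∧ 0 < S u v q p ∧ 0 < S v w q p ∧ 0 < S w u q p)) ↔ ((0 < p 2 ∧ 0 < L u v p ∧ 0 < L v q p ∧ 0 < L q u p ∧ 0 < S u v q p) ∨ (0 < p 2 ∧ 0 < L v w p ∧ 0 < L w q p ∧ 0 < L q v p ∧ 0 < S v w q p) ∨ (0 < p 2 ∧ 0 < L w u p ∧ 0 < L u q p ∧ 0 < L q w p ∧ 0 < S w u q p)))) := by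
  intro h
  set p : Fin 3 → ℝ := ![5 / 2, 1 / 2, 3] with hp
  have h0 : p 0 = 5 / 2 := rfl
  have h1 : p 1 = 1 / 2 := rfl
  have h2 : p 2 = 3 := rfl
  have key := h (fun u v p => (v.re - u.re) * (p 1 - u.im) - (v.im - u.im) * (p 0 - u.re)) (fun _ _ _ => rfl)
    (fun u v w p => (p 0 ^ 2 + p 1 ^ 2 + p 2 ^ 2) * (u.re * (v.im - w.im) - u.im * (v.re - w.re) + (v.re * w.im - v.im * w.re)) - p 0 * (Complex.normSq u * (v.im - w.im) - u.im * (Complex.normSq v - Complex.normSq w) + (Complex.normSq v * w.im - v.im * Complex.normSq w)) + p 1 * (Complex.normSq u * (v.re - w.re) - u.re * (Complex.normSq v - Complex.normSq w) + (Complex.normSq v * w.re - v.re * Complex.normSq w)) - (Complex.normSq u * (v.re * w.im - v.im * w.re) - u.re * (Complex.normSq v * w.im - v.im * Complex.normSq w) + u.im * (Complex.normSq v * w.re - v.re * Complex.normSq w))) (fun _ _ _ _ => rfl)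
    ⟨0, 0⟩ ⟨4, 0⟩ ⟨0, 4⟩ ⟨1, 1⟩
    (by norm_num) (by norm_num) (by norm_num) p
    (by norm_num [h0, h1, h2]) (by norm_num [h0, h1, h2]) (by norm_num [h0, h1, h2])
  norm_num [h0, h1, h2] at key

/-- **The scaffold hypothesis `L w q p ≠ 0` is load-bearing for `stub_exchangePointwise`**: the stub with
this hypothesis deleted (everything else verbatim) is false.  Witness: `(u,v,w,q) = (0, 4, 4i, 1+i)`, `p = (1/2, 5/2, 3)` on the spoke plane through `w, q` over the open segment `(w,q)`, above the big hemisphere: LHS true, RHS false. -/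
theorem not_exchangePointwise_without_spokeW : ¬ (
  ∀ (L : ℂ → ℂ → (Fin 3 → ℝ) → ℝ), (∀ u v p, L u v p = (v.re - u.re) * (p 1 - u.im) - (v.im - u.im) * (p 0 - u.re)) → ∀ (S : ℂ → ℂ → ℂ → (Fin 3 → ℝ) → ℝ), (∀ u v w p, S u v w p = (p 0 ^ 2 + p 1 ^ 2 + p 2 ^ 2) * (u.re * (v.im - w.im) - u.im * (v.re - w.re) + (v.re * w.im - v.im * w.re)) - p 0 * (Complex.normSq u * (v.im - w.im) - u.im * (Complex.normSq v - Complex.normSq w) + (Complex.normSq v * w.im - v.im * Complex.normSq w)) + p 1 * (Complex.normSq u * (v.re - w.re) - u.re * (Complex.normSq v - Complex.normSq w) + (Complex.normSq v * w.re - v.re * Complex.normSq w)) - (Complex.normSq u * (v.re * w.im - v.im * w.re) - u.re * (Complex.normSq v * w.im - v.im * Complex.normSq w) + u.im * (Complex.normSq v * w.re - v.re * Complex.normSq w))) → ∀ (u v w q : ℂ), 0 < L u v ![q.re, q.im, 0] → 0 < L v w ![q.re, q.im, 0] → 0 < L w u ![q.re, q.im, 0] → ∀ (p : Fin 3 → ℝ),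 S u v w p ≠ 0 → L u q p ≠ 0 → L v q p ≠ 0 → (((0 < p 2 ∧ 0 < L u v p ∧ 0 < L v w p ∧ 0 < L w u p ∧ 0 < S u v w p) ∨ (0 < p 2 ∧ S u v w p < 0 ∧ 0 < S u v q p ∧ 0 < S v w q p ∧ 0 < S w u q p)) ↔ ((0 < p 2 ∧ 0 < L u v p ∧ 0 < L v q p ∧ 0 < L q u p ∧ 0 < S u v q p) ∨ (0 < p 2 ∧ 0 < L v w p ∧ 0 < L w q p ∧ 0 < L q v p ∧ 0 < S v w q p) ∨ (0 < p 2 ∧ 0 < L w u p ∧ 0 < L u q p ∧ 0 < L q w p ∧ 0 < S w u q p)))) := by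
  intro h
  set p : Fin 3 → ℝ := ![1 / 2, 5 / 2, 3] with hp
  have h0 : p 0 = 1 / 2 := rfl
  have h1 : p 1 = 5 / 2 := rfl
  have h2 : p 2 = 3 := rfl
  have key := h (fun u v p => (v.re - u.re) * (p 1 - u.im) - (v.im - u.im) * (p 0 - u.re)) (fun _ _ _ => rfl)
    (fun u v w p => (p 0 ^ 2 + p 1 ^ 2 + p 2 ^ 2) * (u.re * (v.im - w.im) - u.im * (v.re - w.re) + (v.re * w.im - v.im * w.re)) - p 0 * (Complex.normSq u * (v.im - w.im) - u.im * (Complex.normSq v - Complex.normSq w) + (Complex.normSq v * w.im - v.im * Complex.normSq w)) + p 1 * (Complex.normSq u * (v.re - w.re) - u.re * (Complex.normSq v - Complex.normSq w) + (Complex.normSq v * w.re - v.re * Complex.normSq w)) - (Complex.normSq u * (v.re * w.im - v.im * w.re) - u.re * (Complex.normSq v * w.im - v.im * Complex.normSq w) + u.im * (Complex.normSq v * w.re - v.re * Complex.normSq w))) (fun _ _ _ _ => rfl)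
    ⟨0, 0⟩ ⟨4, 0⟩ ⟨0, 4⟩ ⟨1, 1⟩
    (by norm_num) (by norm_num) (by norm_num) p
    (by norm_num [h0, h1, h2]) (by norm_num [h0, h1, h2]) (by norm_num [h0, h1, h2])
  norm_num [h0, h1, h2] at key

/-! ## §2 `stub_nullScaffold`: two interior hypotheses are needed -/

/-- **`stub_nullScaffold` needs two of the three interior hypotheses**: with only
`0 < L u v q̂` kept, `q = w` is allowed, the spoke plane `{L w q = 0}` is the whole space and the
scaffold is not null.  Witness `(u, v, w, q) = (0, 1, i, i)`.  (With any TWO interior hypotheses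
the scaffold is still null: they force `u, v, w` pairwise distinct and `q̂ ∉ {u, v, w}`, so all four
polynomials are non-zero — information for the prover, not formalised here.) -/
theorem not_nullScaffold_with_interior₁_only : ¬ (
  ∀ (L : ℂ → ℂ → (Fin 3 → ℝ) → ℝ), (∀ u v p, L u v p = (v.re - u.re) * (p 1 - u.im) - (v.im - u.im) * (p 0 - u.re)) → ∀ (S : ℂ → ℂ → ℂ → (Fin 3 → ℝ) → ℝ), (∀ u v w p, S u v w p = (p 0 ^ 2 + p 1 ^ 2 + p 2 ^ 2) * (u.re * (v.im - w.im) - u.im * (v.re - w.re) + (v.re * w.im - v.im * w.re)) - p 0 * (Complex.normSq u * (v.im - w.im) - u.im * (Complex.normSq v - Complex.normSq w) + (Complex.normSq v * w.im - v.im * Complex.normSq w)) + p 1 * (Complex.normSq u * (v.re - w.re) - u.re * (Complex.normSq v - Complex.normSq w) + (Complex.normSq v * w.re - v.re * Complex.normSq w)) - (Complex.normSq u * (v.re * w.im - v.im * w.re) - u.re * (Complex.normSq v * w.im - v.im * Complex.normSq w) + u.im * (Complex.normSq v * w.re - v.re * Complex.normSq w))) → ∀ (u v w q : ℂ), 0 <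 L u v ![q.re, q.im, 0] → MeasureTheory.volume {p : Fin 3 → ℝ | S u v w p = 0 ∨ L u q p = 0 ∨ L v q p = 0 ∨ L w q p = 0} = 0) := by
  intro h
  have key := h (fun u v p => (v.re - u.re) * (p 1 - u.im) - (v.im - u.im) * (p 0 - u.re)) (fun _ _ _ => rfl)
    (fun u v w p => (p 0 ^ 2 + p 1 ^ 2 + p 2 ^ 2) * (u.re * (v.im - w.im) - u.im * (v.re - w.re) + (v.re * w.im - v.im * w.re)) - p 0 * (Complex.normSq u * (v.im - w.im) - u.im * (Complex.normSq v - Complex.normSq w) + (Complex.normSq v * w.im - v.im * Complex.normSq w)) + p 1 * (Complex.normSq u * (v.re - w.re) - u.re * (Complex.normSq v - Complex.normSq w) + (Complex.normSq v * w.re - v.re * Complex.normSq w)) - (Complex.normSq u * (v.re * w.im - v.im * w.re) - u.re * (Complex.normSq v * w.im - v.im * Complex.normSq w) + u.im * (Complex.normSq v * w.re - v.re * Complex.normSq w))) (fun _ _ _ _ => rfl)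
    ⟨0, 0⟩ ⟨1, 0⟩ ⟨0, 1⟩ ⟨0, 1⟩ (by norm_num)
  have hbox : volume (Icc (0 : Fin 3 → ℝ) 1) = 0 :=
    measure_mono_null (fun p _ => show _ ∨ _ from Or.inr <| Or.inr <| Or.inr <| by norm_num) key
  rw [Real.volume_Icc_pi] at hbox
  simp at hbox

end Summit.KontsevichZagierPeriods.HyperbolicBloch.ExchangeStubsMinimal

end
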